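import Literature.AnabelianGeometry.EtaleTheta.Discharge.Sec1Rmk131HalfCarrierModelChi
import HarnessLib

/-!
# [EtTh] Prop. 1.3 ∧ Rmk. 1.3.1 with REAL `½`-coefficients are JOINTLY SATISFIED at the χ-twisted root model —
# by the `log(Ü)`-twisted theta class, which does NOT descend to `Y`

S. Mochizuki, *The étale theta function and its Frobenioid-theoretic manifestations*, Publ. RIMS **45**
(2009), §1, Prop. 1.3 pp. 19–21, Rmk. 1.3.1 p. 21 (printed 245–247): "the denominators `½` in Proposition
1.3 are by no means superfluous … the divisor `D₁` on `Ÿ` clearly does not descend to `Y`"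
[cite: MochizukiEtTh2009, Rmk 1.3.1 p.21]. Layer L2 of the abc-iut cell, seat abc-iut-L2-t1 (gen 11; sequel of
the R1091 HALF-CARRIER pair `EtaleThetaDataHalfCarrier` / `Discharge/Sec1Rmk131HalfCarrierModelChi`). PROOF-ONLY
(no `def`, no instance, no `Prop` fact).

The companion file decided, at `ThetaSetting.modelχ p` and for the model's theta class `η̈ := etaDdχ`, that
`Prop13` holds with content while `Rmk131` FAILS for every choice of the `Y`-class — because `etaDdχ = etaχ|_Ÿ`
descends to `Y`. THIS FILE shows that the two typed predicates, with their printed meaning restored by the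
half-carrier, are nevertheless JOINTLY SATISFIABLE at the same Kummer-carrying model, by the class that print's
mechanism predicts: twist `η̈` by a class that does NOT descend to `Y` but whose SQUARE does —
abc-iut-w5-d171's `log(Ü)` (`logUddχ`; `log(U)|_Ÿ = log(Ü)²`, `res_logUχ`; `log(Ü) ∉ Im(res)`, abc-iut-f-117's
`logUddχ_not_mem_range_res`). With `η̈′ := etaDdχ · infl log(Ü) ∈ H¹(Π^tp_Ÿ, Δ_Θ)` and the `Y`-class
`e′ := etaχ² · infl log(U)` ("`2·η^Θ`"):

* `prop13_half_twist_modelχ` — **Prop. 1.3 HOLDS with content**: `e′|_Ÿ = (η̈′)²` (`eta_res_Ydd`), and the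
  `Z̈_N`-clause by COMPUTATION: on `Π^tp_{Z̈_N} ⊆ Π^tp_{Y_{2N}}` the `y`-coordinate is `≡ 0 (mod 2N)`, so
  `ŷ ∈ Ẑ^{2N}` (`ZHatLevel.level_eq_one_iff_exists_pow`) and the `log(U)`-cocycle `g ↦ c^{ŷ(g)}` is
  `(2N)·Δ_Θ`-valued there (`reduceMod_res_inflTheta_logUχ`); the `etaχ²`-part by the companion file;
* `rmk131_half_twist_modelχ` — **Rmk. 1.3.1 HOLDS**: `e′ ≠ κ_Y(a²)·x²` for all `a ∈ O^×_{K/K̈}`, `x ∈ H¹(Π^tp_Y, Δ_Θ)`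
  — abc-iut-f-117's parity mechanism (`Sec1Rmk131ModelChiNoHalf`) lifted from `(Π^tp_Y)^Θ` to `Π^tp_Y`: at the
  geometric element `x₀ = (b, 0) ⋊ 1 ∈ Π^tp_Y` (which centralises `Δ_Θ`, so cohomologous cocycles agree there)
  a square root would give `f(x₀)² = c^{ι(1)} · 1` in `Δ_Θ ≅ Ẑ` (Kummer cocycles of constants vanish at `x₀`,
  `KummerCore.apply_eq_one_of_kumY_eq_mk`), and `ι(1) ∉ 2Ẑ` (`sq_ne_deltaThetaCoordχ_iotaZ_one`) —
  `inflTheta_logUχ_mul_kumY_not_sq`;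
* `exists_half_prop13_and_rmk131_modelχ` — census ∃-form: **at `(modelχ, kummerDataχ)` there is an étale-theta
  datum with REAL `½`-groups satisfying `Prop13 ∧ Rmk131`** (so its `e′ = 2·η^Θ` is not a square over `Y`, in
  particular `≠ 1`); together with the companion's negative
  decision for `etaDdχ` BOTH truth values of `Rmk131` are realised WITH PRINT'S SEMANTICS at a Kummer-carrying
  model of record, and the dividing line is exactly print's: descent of `η̈^Θ` to `Y`.

HONEST FRAMING: statements about the semi-synthetic χ-model (consistency / non-vacuity evidence for the typed
§1 interface); nothing of [EtTh] is asserted; no side is taken on [IUTchIII] Cor. 3.12; typed ≠ proved.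
-/

noncomputable section

namespace Literature.AnabelianGeometry.EtaleTheta.SettingModel

open Literature.AnabelianGeometry.SemiGraphs
open scoped IsMulCommutative

variable (p : ℕ) [Fact p.Prime]

/-! ### The `log(U)`-cocycle on `Π^tp_{Z̈_N}` is `(2N)·Δ_Θ`-valued -/

/-- On `Π^tp_{Z̈_N} ⊆ Π^tp_{Y_{2N}}` the `y`-coordinate is a `(2N)`-th power in `Ẑ` (`y ≡ 0 (mod 2N)` on
`Δ^tp_{Y_{2N}}`). [cite: MochizukiEtTh2009, §1 p.17] -/
theorem exists_pow_eq_yCoordχ_of_mem_GtpZddN (N : ℕ+) {g : PiTpχ p}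
    (hg : g ∈ (ThetaSetting.modelχ p).GtpZddN N) : ∃ z : ZH, z ^ (2 * (N : ℕ)) = yCoordχ p g := by
  have hY : g ∈ YNχ p (2 * N) := (Subgroup.mem_inf.mp (Subgroup.mem_inf.mp hg).1).1
  have hy : (levelHom (2 * N) g.left).y = 0 := ((Subgroup.mem_inf.mp ((GfpTwistData.mem_YN _).mp hY).1).2).2
  have hmod : modN (2 * N) (eHatB (gfpFst g.left)) = 1 := (hHat_y_eq_zero_iff (2 * N) (gfpFst g.left)).mp hy
  rw [modN_eq_level, ZHatLevel.level_eq_one_iff_exists_pow] at hmod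
  obtain ⟨z, hz⟩ := hmod
  refine ⟨z, ?_⟩
  rw [show (2 * (N : ℕ)) = ((2 * N : ℕ+) : ℕ) by simp]
  exact hz

/-- **The `Z̈_N`-clause for the inflated `log(U)`**: `infl log(U) ∈ H¹(Π^tp_Y, Δ_Θ)`, restricted to `Π^tp_{Z̈_N}` and
reduced modulo `(2N)·Δ_Θ`, is trivial (its cocycle `g ↦ c^{ŷ(g)}` is `(2N)·Δ_Θ`-valued there).
[cite: MochizukiEtTh2009, Prop 1.3 p.20] -/
theorem reduceMod_res_inflTheta_logUχ (N : ℕ+) :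
    (ThetaSetting.modelχ p).reduceMod (2 * N) ((ThetaSetting.modelχ p).GtpZddN N)
      (ContH1.res (ThetaSetting.modelχ p).toTheta (ThetaSetting.modelχ p).DeltaTheta
        ((ThetaSetting.modelχ p).GtpZddN_le_GtpY N)
        ((ThetaSetting.modelχ p).inflTheta (ThetaSetting.modelχ p).GtpY (logUχ p))) = 1 := by
  haveI := (ThetaSetting.modelχ p).lDeltaTheta_normal (2 * (N : ℕ))
  change (ThetaSetting.modelχ p).reduceMod (2 * N) ((ThetaSetting.modelχ p).GtpZddN N)
      (ContH1.mk (fun g : ↥((ThetaSetting.modelχ p).GtpZddN N) => deltaThetaCoordχ p (yCoordχ p (g : PiTpχ p))) _) = 1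
  refine ContH1.reduce_mk_eq_one_of_forall_mem (ThetaSetting.modelχ p).toTheta (ThetaSetting.modelχ p).DeltaTheta
    ((ThetaSetting.modelχ p).lDeltaTheta (2 * (N : ℕ))) ((ThetaSetting.modelχ p).GtpZddN N) _ _ fun g => ?_
  obtain ⟨z, hz⟩ := exists_pow_eq_yCoordχ_of_mem_GtpZddN p N g.2
  refine ⟨cThetaχ p z, cThetaχ_mem_ker p z, ?_⟩
  rw [coe_deltaThetaCoordχ, ← hz, map_pow]

/-! ### Prop. 1.3 for the twisted datum -/

/-- `e′|_Ÿ = (η̈′)²`: `(etaχ² · infl log(U))|_Ÿ = (etaDdχ · infl log(Ü))²` (`log(U)|_Ÿ = log(Ü)²`).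
[cite: MochizukiEtTh2009, Prop 1.3 p.21] -/
theorem res_etaχ_sq_mul_inflTheta_logUχ :
    ContH1.res (ThetaSetting.modelχ p).toTheta (ThetaSetting.modelχ p).DeltaTheta (ThetaSetting.modelχ p).GtpYdd_le_GtpY
        (etaχ p ^ 2 * (ThetaSetting.modelχ p).inflTheta (ThetaSetting.modelχ p).GtpY (logUχ p)) =
      (etaDdχ p * (ThetaSetting.modelχ p).inflTheta (ThetaSetting.modelχ p).GtpYdd (logUddχ p)) ^ 2 := by
  rw [map_mul, map_pow, ThetaSetting.KummerData.res_inflTheta_GtpY, res_logUχ, map_pow, ← mul_pow]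
  rfl

/-- **Prop. 1.3 HOLDS with content at the χ-model for the `log(Ü)`-twisted theta class**
`η̈′ := etaDdχ · infl log(Ü)`, `e′ := etaχ² · infl log(U)`, over the model's Kummer datum `kummerDataχ`.
[cite: MochizukiEtTh2009, Prop 1.3 p.20] -/
theorem prop13_half_twist_modelχ :
    ThetaSetting.Prop13 ((kummerDataχ p).etaleThetaDataHalf
      (etaDdχ p * (ThetaSetting.modelχ p).inflTheta (ThetaSetting.modelχ p).GtpYdd (logUddχ p))
      (etaχ p ^ 2 * (ThetaSetting.modelχ p).inflTheta (ThetaSetting.modelχ p).GtpY (logUχ p))) := by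
  refine ((kummerDataχ p).prop13_half_iff _ _).mpr ⟨⟨_, (kummerDataχ p).mem_thetaClasses_etaleThetaDataHalf _ _,
    res_etaχ_sq_mul_inflTheta_logUχ p⟩, fun N => ?_⟩
  rw [ContH1.res_reduce, map_mul, map_mul, reduceMod_res_etaχ_sq, reduceMod_res_inflTheta_logUχ, mul_one]

/-! ### Rmk. 1.3.1 for the twisted datum: the parity mechanism at the `Π^tp_Y`-level -/

/-- **`infl(log(U) · κ(u))` is not a square in `H¹(Π^tp_Y, Δ_Θ)`** for ANY Kummer class `κ(u)` of the model's Kummer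
data — abc-iut-f-117's `logUχ_mul_kumY_not_sq` lifted along `Π^tp_Y ↠ (Π^tp_Y)^Θ`: a square root `[f]` would give
`f(x₀)² = c^{ι(1)}` at `x₀ = (b, 0) ⋊ 1`, which centralises `Δ_Θ` and at which Kummer cocycles of constants vanish.
[cite: MochizukiEtTh2009, Rmk 1.3.1 p.21] -/
theorem inflTheta_logUχ_mul_kumY_not_sq (u : ↥(kummerCoreχ p).invY)
    (z : (ThetaSetting.modelχ p).H1 (ThetaSetting.modelχ p).GtpY) :
    z ^ 2 ≠ (ThetaSetting.modelχ p).inflTheta (ThetaSetting.modelχ p).GtpY (logUχ p * (kummerDataχ p).kumY u) := by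
  obtain ⟨f, hf, rfl⟩ := ContH1.exists_mk_eq z
  obtain ⟨g, hg, hgeq⟩ := ContH1.exists_mk_eq ((kummerDataχ p).kumY u)
  have hgx : g ⟨_, toTheta_inl_b_mem_gtpY_map p⟩ = 1 :=
    (kummerCoreχ p).apply_eq_one_of_kumY_eq_mk u hgeq.symm ⟨_, toTheta_inl_b_mem_gtpY_map p⟩
      (augTheta_kummerCoreχ_inl_b p) (conjNormal_toTheta_inl_b p)
  rw [← hgeq, logUχ, ContH1.mk_mul_mk, pow_two, ContH1.mk_mul_mk]
  intro h
  -- both sides are now explicit classes of cocycles on `Π^tp_Y`; evaluate at `x₀ = (b, 0) ⋊ 1`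
  let x₀ : ↥(ThetaSetting.modelχ p).GtpY :=
    ⟨SemidirectProduct.inl (bPowGfp (iotaZ (Multiplicative.ofAdd 1))), inl_bPowGfp_mem_gtpY p _⟩
  have hcen : ∀ a : ↥(ThetaSetting.modelχ p).DeltaTheta,
      MulAut.conjNormal ((ThetaSetting.modelχ p).toTheta (x₀ : PiTpχ p)) a = a :=
    fun a => conjNormal_toTheta_eq_self p (SemidirectProduct.right_inl _) a
  -- cohomologous cocycles agree at `x₀` (principal crossed homomorphisms vanish where `Δ_Θ` is centralised)
  obtain ⟨a, ha⟩ := (ContH1.mk_eq_mk_iff _ _ _ _ _).mp h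
  have key := ha x₀
  rw [hcen a, mul_inv_cancel, inv_mul_eq_one] at key
  -- read the inflated cocycle at `x₀` through a `Δ_Θ`-typed alias of the `log(U)`-cocycle
  let L : ↥((ThetaSetting.modelχ p).GtpY.map (ThetaSetting.modelχ p).toTheta) → ↥(ThetaSetting.modelχ p).DeltaTheta :=
    logUFunχ p _
  change f x₀ * f x₀ = L ⟨_, toTheta_inl_b_mem_gtpY_map p⟩ * g ⟨_, toTheta_inl_b_mem_gtpY_map p⟩ at key
  have hL : L ⟨_, toTheta_inl_b_mem_gtpY_map p⟩ = deltaThetaCoordχ p (iotaZ (Multiplicative.ofAdd 1)) :=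
    logUFunχ_inl_b p
  rw [hL, hgx, mul_one, ← pow_two] at key
  exact sq_ne_deltaThetaCoordχ_iotaZ_one p _ key

/-- **Rmk. 1.3.1 HOLDS at the χ-model for the `log(Ü)`-twisted theta class** (REAL `½`-groups): `e′ = etaχ² · infl
log(U)` is not of the form `κ_Y(a²) · x²` — "the denominators `½` are by no means superfluous" realised at a
Kummer-carrying model by a class whose square descends to `Y` but which itself does not.
[cite: MochizukiEtTh2009, Rmk 1.3.1 p.21] -/
theorem rmk131_half_twist_modelχ :
    ThetaSetting.Rmk131 ((kummerDataχ p).etaleThetaDataHalf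
      (etaDdχ p * (ThetaSetting.modelχ p).inflTheta (ThetaSetting.modelχ p).GtpYdd (logUddχ p))
      (etaχ p ^ 2 * (ThetaSetting.modelχ p).inflTheta (ThetaSetting.modelχ p).GtpY (logUχ p))) := by
  rw [ThetaSetting.KummerData.rmk131_half_iff]
  intro a x hx
  -- `κ_Y(a²) · etaχ² · infl log(U) = x²` ⟹ `(x · etaχ⁻¹)² = infl(log(U) · κ_Y(a²))`
  apply inflTheta_logUχ_mul_kumY_not_sq p ((kummerDataχ p).toKHat ((ThetaSetting.modelχ p).sqToK a)) (x * (etaχ p)⁻¹)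
  have hκ : (kummerDataχ p).kumSqY a = (ThetaSetting.modelχ p).inflTheta (ThetaSetting.modelχ p).GtpY
      ((kummerDataχ p).kumY ((kummerDataχ p).toKHat ((ThetaSetting.modelχ p).sqToK a))) := rfl
  rw [map_mul, ← hκ, mul_pow, inv_pow, ← hx, mul_comm (etaχ p ^ 2), ← mul_assoc, mul_inv_cancel_right, mul_comm]

/-- **Census ∃-form — `Prop13 ∧ Rmk131` JOINTLY SATISFIED at `(modelχ, kummerDataχ)` with REAL `½`-groups**
(witness `η̈′ = etaDdχ · infl log(Ü)`, `e′ = etaχ² · infl log(U)`; in particular `e′ = 2·η^Θ` is not a square over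
`Y`). Together with the companion's `exists_half_prop13_and_not_rmk131_modelχ` BOTH truth values of `Rmk131` are
realised at this Kummer-carrying model with print's semantics. [cite: MochizukiEtTh2009, Rmk 1.3.1 p.21] -/
theorem exists_half_prop13_and_rmk131_modelχ :
    ∃ E : (ThetaSetting.modelχ p).EtaleThetaData, E.toKummerData = kummerDataχ p ∧
      ThetaSetting.Prop13 E ∧ ThetaSetting.Rmk131 E ∧ ∀ x : (ThetaSetting.modelχ p).H1 (ThetaSetting.modelχ p).GtpY,
        E.ofIntegralY x ≠ E.eta :=
  ⟨_, rfl, prop13_half_twist_modelχ p, rmk131_half_twist_modelχ p, fun x hx =>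
    rmk131_half_twist_modelχ p 1 x (by rw [map_one, one_mul]; exact hx.symm)⟩

end Literature.AnabelianGeometry.EtaleTheta.SettingModel

end
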